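import Mathlib.Algebra.Polynomial.Eval.Irreducible
import Literature.NumberTheory.DiophantineGeometry.PlaneCurveGenusBoundProofs
import Literature.NumberTheory.DiophantineGeometry.PlaneCurveRationalPlaceProofs
import Literature.NumberTheory.DiophantineGeometry.PlaneCurveFunctionFieldProofs
import Literature.NumberTheory.DiophantineGeometry.PlaneCurveConstantFieldProofs
import HarnessLib

/-!
# Rational points on absolutely irreducible plane curves over finite fields (Weil's estimate)

The existence half of Weil's estimate for possibly singular affine plane curves, in the explicit
form used by A. Cafure and G. Matera, *Improved explicit estimates on the number of solutions of
equations over a finite field*, Finite Fields Appl. 12 (2006), proof of Thm. 5.4 ("Weil's estimate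
(1) shows that `𝒞` has at least `q - (δ-1)(δ-2)q^{1/2} - δ - 1` `q`-rational zeros"):

* `exists_evalEval_eq_zero_of_irreducible_map`: let `Φ ∈ 𝔽_q[X][Y]` be monic of degree `d` in `Y`
  and of total degree `d` (`deg_X (coeff of Yⁱ) + i ≤ d`), absolutely irreducible (irreducible
  image in `K̄[X][Y]` for an embedding of `𝔽_q` into an algebraically closed field). If
  `d + (d-1)(d-2)√q < q + 1` then `Φ` has an `𝔽_q`-rational zero.

Proof (assembling the sibling files): `F = 𝔽_q(X)[Y]/(Φ)` is an algebraic function field with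
full constant field `𝔽_q` (`PlaneCurveFunctionFieldProofs`, `PlaneCurveConstantFieldProofs`), of
genus `g` with `2g ≤ (d-1)(d-2)` (`PlaneCurveGenusBoundProofs`), in which `x` has pole divisor of
degree `d` and `y ∈ ℒ((x)_∞)`; by the Hasse–Weil bound there are `≥ q + 1 - 2g√q > d` rational
places, at most `d` of them poles of `x`, and the residues of `(x, y)` at a finite rational place
form a rational zero of `Φ` (`PlaneCurveRationalPlaceProofs`).

## References

* A. Cafure, G. Matera, Finite Fields Appl. 12 (2006) 155–185, §1 eq. (1) and proof of Thm. 5.4.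
  [CafureMatera2006]
* H. Stichtenoth, *Algebraic Function Fields and Codes*, 2nd ed., GTM 254, Springer 2009,
  Thm. 5.2.3. [Stichtenoth2009]
-/

noncomputable section

open scoped Classical Polynomial.Bivariate IntermediateField
open Polynomial

namespace Literature.NumberTheory.DiophantineGeometry.AlgFunctionField

universe u

variable {K : Type u} [Field K]

/-- An absolutely irreducible monic `Φ ∈ K[X][Y]` is irreducible over `K`. [folklore] -/
theorem irreducible_of_irreducible_map {Kbar : Type*} [Field Kbar] (σ : K →+* Kbar) {Φ : K[X][Y]}
    (hm : Φ.Monic) (hirr : Irreducible (Φ.map (mapRingHom σ))) : Irreducible Φ :=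
  hm.irreducible_of_irreducible_map _ _ hirr

/-- **Rational points on absolutely irreducible plane curves (Weil's estimate, existence form;
Cafure–Matera 2006, proof of Thm. 5.4).** Let `K = 𝔽_q` and let `Φ ∈ K[X][Y]` be monic of degree
`d` in `Y` with `deg_X (coeff of Yⁱ) + i ≤ d` (total degree `d`), whose image in `K̄[X][Y]` is
irreducible for some embedding `σ` of `K` into an algebraically closed field. If
`d + (d-1)(d-2)√q < q + 1` then `Φ(a, b) = 0` for some `(a, b) ∈ K²`. Proof: Hasse–Weil for the
function field `K(X)[Y]/(Φ)` (full constant field `K` by absolute irreducibility, genus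
`≤ (d-1)(d-2)/2`), `≤ d` rational places at infinity, residues at a finite rational place.
[cite: CafureMatera2006, proof of Thm. 5.4] [cite: Stichtenoth2009, Thm. 5.2.3] -/
theorem exists_evalEval_eq_zero_of_irreducible_map [Fintype K] {Φ : K[X][Y]} (hm : Φ.Monic)
    (hdeg : ∀ i, (Φ.coeff i).natDegree + i ≤ Φ.natDegree)
    {Kbar : Type*} [Field Kbar] [IsAlgClosed Kbar] (σ : K →+* Kbar)
    (hirr : Irreducible (Φ.map (mapRingHom σ)))
    (hq : (Φ.natDegree : ℝ) + ((Φ.natDegree - 1) * (Φ.natDegree - 2) : ℕ) *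
      √(Fintype.card K : ℝ) < (Fintype.card K : ℝ) + 1) :
    ∃ a b : K, Φ.evalEval a b = 0 := by
  -- the function field `F = K(X)[Y]/(Φ)`
  set ΦL : (RatFunc K)[X] := Φ.map (algebraMap K[X] (RatFunc K)) with hΦL
  have hmL : ΦL.Monic := hm.map _
  have hirrL : Irreducible ΦL :=
    irreducible_map_ratFunc hm (irreducible_of_irreducible_map σ hm hirr)
  haveI : Fact (Irreducible ΦL) := ⟨hirrL⟩
  set pb := AdjoinRoot.powerBasis hirrL.ne_zero with hpb
  have hgen : pb.gen = AdjoinRoot.root ΦL := AdjoinRoot.powerBasis_gen _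
  have hmin : minpoly (RatFunc K) pb.gen = ΦL := AdjoinRoot.minpoly_powerBasis_gen_of_monic hmL
  have hdim : pb.dim = Φ.natDegree := by
    rw [← pb.natDegree_minpoly, hmin, hm.natDegree_map]
  haveI : IsAlgFunctionField K (AdjoinRoot ΦL) := isAlgFunctionField_of_powerBasis pb
  haveI : IsIntegrallyClosedIn K (AdjoinRoot ΦL) :=
    isIntegrallyClosedIn_of_irreducible_map pb hm hmin σ hirr
  -- `x`, `y`, `Φ(x, y) = 0`, `y ∈ ℒ((x)_∞)`
  set x : AdjoinRoot ΦL := algebraMap K[X] (AdjoinRoot ΦL) X with hx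
  have hx : Transcendental K x := transcendental_algebraMap_X K (AdjoinRoot ΦL)
  have hx0 : x ≠ 0 := algebraMap_X_ne_zero K (AdjoinRoot ΦL)
  have hΦy : aeval pb.gen ΦL = 0 := by
    rw [hgen, AdjoinRoot.aeval_eq, AdjoinRoot.mk_self]
  have hy : pb.gen ∈ riemannRochSpace (principalDivisor K x)⁻ :=
    mem_riemannRochSpace_negPart_of_aeval_eq_zero hΦy hm hdeg
  have hΦxy : (Φ.map (mapRingHom (algebraMap K (AdjoinRoot ΦL)))).evalEval x pb.gen = 0 :=
    evalEval_algebraMap_X_eq_zero hΦy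
  -- genus bound and degree of the pole divisor
  have hfin : Module.finrank K⟮x⟯ (AdjoinRoot ΦL) = pb.dim := finrank_adjoin_algebraMap_X_eq_dim pb
  have hgenus : 2 * genus K (AdjoinRoot ΦL) ≤ (pb.dim - 1) * (pb.dim - 2) :=
    two_mul_genus_le_of_planeModel hx hfin hy (linearIndependent_monomial pb)
  have hdegx : Divisor.degree (principalDivisor K x)⁻ = (pb.dim : ℤ) := by
    rw [degree_negPart_principalDivisor_eq hx, hfin]
  -- the numerical hypothesis of `exists_evalEval_eq_zero_of_lt`
  have hlt : ((Divisor.degree (principalDivisor K x)⁻ : ℤ) : ℝ) <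
      (Fintype.card K : ℝ) + 1 - 2 * genus K (AdjoinRoot ΦL) * √(Fintype.card K : ℝ) := by
    rw [hdegx, hdim] at *
    rw [hdim] at hgenus
    have hg : (2 * genus K (AdjoinRoot ΦL) : ℝ) ≤ ((Φ.natDegree - 1) * (Φ.natDegree - 2) : ℕ) := by
      exact_mod_cast hgenus
    have hs : 0 ≤ √(Fintype.card K : ℝ) := Real.sqrt_nonneg _
    push_cast
    nlinarith [mul_le_mul_of_nonneg_right hg hs]
  exact exists_evalEval_eq_zero_of_lt hx0 hlt hy hΦxy

/-- **Rational points on absolutely irreducible plane curves (Weil's estimate, existence form;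
Cafure–Matera 2006, proof of Thm. 5.4)** — corrected total-degree hypothesis (the unprimed
version above asks `deg_X (coeff of Yⁱ) + i ≤ d` for all `i`, which fails for `i > d`; here only
`i < d` is required, as in the proof). Let `K = 𝔽_q` and let `Φ ∈ K[X][Y]` be monic of degree `d`
in `Y` with `deg_X (coeff of Yⁱ) + i ≤ d` for `i < d` (total degree `d`), whose image in
`K̄[X][Y]` is irreducible for some embedding `σ` of `K` into an algebraically closed field. If
`d + (d-1)(d-2)√q < q + 1` then `Φ(a, b) = 0` for some `(a, b) ∈ K²`.
[cite: CafureMatera2006, proof of Thm. 5.4] [cite: Stichtenoth2009, Thm. 5.2.3] -/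
theorem exists_evalEval_eq_zero_of_irreducible_map' [Fintype K] {Φ : K[X][Y]} (hm : Φ.Monic)
    (hdeg : ∀ i, i < Φ.natDegree → (Φ.coeff i).natDegree + i ≤ Φ.natDegree)
    {Kbar : Type*} [Field Kbar] [IsAlgClosed Kbar] (σ : K →+* Kbar)
    (hirr : Irreducible (Φ.map (mapRingHom σ)))
    (hq : (Φ.natDegree : ℝ) + ((Φ.natDegree - 1) * (Φ.natDegree - 2) : ℕ) *
      √(Fintype.card K : ℝ) < (Fintype.card K : ℝ) + 1) :
    ∃ a b : K, Φ.evalEval a b = 0 := by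
  -- the function field `F = K(X)[Y]/(Φ)`
  set ΦL : (RatFunc K)[X] := Φ.map (algebraMap K[X] (RatFunc K)) with hΦL
  have hmL : ΦL.Monic := hm.map _
  have hirrL : Irreducible ΦL :=
    irreducible_map_ratFunc hm (irreducible_of_irreducible_map σ hm hirr)
  haveI : Fact (Irreducible ΦL) := ⟨hirrL⟩
  set pb := AdjoinRoot.powerBasis hirrL.ne_zero with hpb
  have hgen : pb.gen = AdjoinRoot.root ΦL := AdjoinRoot.powerBasis_gen _
  have hmin : minpoly (RatFunc K) pb.gen = ΦL := AdjoinRoot.minpoly_powerBasis_gen_of_monic hmL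
  have hdim : pb.dim = Φ.natDegree := by
    rw [← pb.natDegree_minpoly, hmin, hm.natDegree_map]
  haveI : IsAlgFunctionField K (AdjoinRoot ΦL) := isAlgFunctionField_of_powerBasis pb
  haveI : IsIntegrallyClosedIn K (AdjoinRoot ΦL) :=
    isIntegrallyClosedIn_of_irreducible_map pb hm hmin σ hirr
  -- `x`, `y`, `Φ(x, y) = 0`, `y ∈ ℒ((x)_∞)`
  set x : AdjoinRoot ΦL := algebraMap K[X] (AdjoinRoot ΦL) X with hx
  have hx : Transcendental K x := transcendental_algebraMap_X K (AdjoinRoot ΦL)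
  have hx0 : x ≠ 0 := algebraMap_X_ne_zero K (AdjoinRoot ΦL)
  have hΦy : aeval pb.gen ΦL = 0 := by
    rw [hgen, AdjoinRoot.aeval_eq, AdjoinRoot.mk_self]
  have hy : pb.gen ∈ riemannRochSpace (principalDivisor K x)⁻ :=
    mem_riemannRochSpace_negPart_of_aeval_eq_zero' hΦy hm hdeg
  have hΦxy : (Φ.map (mapRingHom (algebraMap K (AdjoinRoot ΦL)))).evalEval x pb.gen = 0 :=
    evalEval_algebraMap_X_eq_zero hΦy
  -- genus bound and degree of the pole divisor
  have hfin : Module.finrank K⟮x⟯ (AdjoinRoot ΦL) = pb.dim := finrank_adjoin_algebraMap_X_eq_dim pb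
  have hgenus : 2 * genus K (AdjoinRoot ΦL) ≤ (pb.dim - 1) * (pb.dim - 2) :=
    two_mul_genus_le_of_planeModel hx hfin hy (linearIndependent_monomial pb)
  have hdegx : Divisor.degree (principalDivisor K x)⁻ = (pb.dim : ℤ) := by
    rw [degree_negPart_principalDivisor_eq hx, hfin]
  have hlt : ((Divisor.degree (principalDivisor K x)⁻ : ℤ) : ℝ) <
      (Fintype.card K : ℝ) + 1 - 2 * genus K (AdjoinRoot ΦL) * √(Fintype.card K : ℝ) := by
    rw [hdegx, hdim] at *
    rw [hdim] at hgenus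
    have hg : (2 * genus K (AdjoinRoot ΦL) : ℝ) ≤ ((Φ.natDegree - 1) * (Φ.natDegree - 2) : ℕ) := by
      exact_mod_cast hgenus
    have hs : 0 ≤ √(Fintype.card K : ℝ) := Real.sqrt_nonneg _
    push_cast
    nlinarith [mul_le_mul_of_nonneg_right hg hs]
  exact exists_evalEval_eq_zero_of_lt hx0 hlt hy hΦxy

end Literature.NumberTheory.DiophantineGeometry.AlgFunctionField
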